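import Mathlib
import Summits.Ventures.HodgeRepro2.T5ConductorArithmetic
import Summits.Ventures.HodgeRepro2.T6N5TateTwist
import Summits.Ventures.HodgeRepro2.T6N5Hyp
import Summits.Ventures.HodgeRepro2.T6N5LocalDatum
import Summits.Ventures.HodgeRepro2.T6N5LocalHyp
import Summits.Ventures.HodgeRepro2.T6N5Local
import Summits.Ventures.HodgeRepro2.T6N5LocalCharDatum
import Summits.Ventures.HodgeRepro2.T6N5LocalInertHyp

/-!
# T6N5LocalInert — Tier 6, M2 sub-step N5 (t6-p8's half): case (iii) of Theorem N5.T2 at an INERT place in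
kernel — the binder `hiii` of `N5Local_main` discharged from Gan–Gross–Prasad's Proposition 3.1, Tate's
(3.2.2)–(3.2.3) and conductor arithmetic

* `eps_of_isCS` — LEMMA N5.L5 (TIER5 §N5.12.2): `ε_v(ξ) = (−1)^{a(ξ)+d_v}` for every smooth conjugate-symplectic
  `ξ`: the displayed Proposition 3.1 gives `ε(½, ξ, ψ₀) = (−1)^{a(ξ)+1}` for the normalised `ψ₀`; the displayed
  Tate (3.2.2)–(3.2.3) (t6-p7's `Hyp.Tate1979_3_2_2_3`, through `TateData.epsS_tw_half`) gives
  `ε(½, ξ, ψ₀(t·)) = ξ(t)·ε(½, ξ, ψ₀)`; and `ξ(t) = η_v(t) = (−1)^{d_v+1}` (`ξ|_{F_v^×} = η_v`, `t ∈ F_v^×`,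
  the datum condition `hηt`).
* `hiii_of_inert` — case (iii) of THEOREM N5.T2 in the pair form of `N5Local.localSolution_of_pair`: for the
  sign `s = s_a = s_b`, a conjugate-symplectic `a` of conductor `n_a ∈ {1, 2}` with `ε_v(a) = s` and a
  conjugate-symplectic `c` of conductor `n_a + 1` with `ε_v(c) = −s` (`CharDatum.exists_isCS_cond` from an
  unramified conjugate-symplectic `μ` and conjugate-orthogonal characters of every exact level — the datum
  conditions (A10) / «μ|_{F_v^×} = η_v exists», p4's accepted `T5AdicCompletionInert.exists_character_exact_level`
  / `T5UnitsCharacterExtension` on Mathlib's completions); then `a(c⁻¹a²) = a(c)` (conductor arithmetic, p4's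
  `conductor_mul_eq_of_lt`) so `ε_v(c⁻¹a²) = −s` — TIER5 §N5.12.2 (iii-inert)′ with
  `(ξ_a, ξ_b, ξ_c, ξ_d) = (a, a, c, c⁻¹a²)`.
* `N5Local_main_inert` — THEOREM N5.T2 at an inert place with `hiii` discharged (`hA1` as in `N5Local_main`).
Binder classes (TARGET-T6 §9.5): `hG` PRINT (GGP2012ex Prop. 3.1) · `hT` PRINT (Tate (3.2.2)–(3.2.3)) · `hc`
convention (t6-p7's normalisation conventions) · `hU` (antitone filtration), `hψδ` (`ψ_δ = ψ₀(t·)`), `ht`, `hηt`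
(`η_v(t) = (−1)^{d_v+1}`), `hin`, `hψ0`, `hμ` (an unramified conjugate-symplectic character), `hβ` = DATUM conditions (each discharged on Mathlib's completions
by p4's accepted kernel, Layer III) · `h35` PRINT · `hA1`, `hW`, `hη`, `hχW` as in `N5Local_main`.
README §8(d): uses an L-value-free non-vanishing device: NO.
-/

namespace Summit.Ventures.HodgeRepro2.T6.N5LocalInert

open Summit.Ventures.HodgeRepro2.T6.N5LocalDatum Summit.Ventures.HodgeRepro2.T6.N5TateTwist
  Summit.Ventures.HodgeRepro2.T5ConductorArithmetic Summit.Ventures.HodgeRepro2.T6.N5LocalCharDatum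
  Summit.Ventures.HodgeRepro2.T6.N5LocalCharDatum.CharDatum
  Summit.Ventures.HodgeRepro2.T6.N5LocalInertDatum
  Summit.Ventures.HodgeRepro2.T6.N5Local Summit.Ventures.HodgeRepro2.T6.Hyp

variable (D : InertSignDatum)

/-! ### LEMMA N5.L5 — the parity rule at the datum's `ψ_δ` -/

/-- LEMMA N5.L5 (TIER5 §N5.12.2): for every smooth conjugate-symplectic `ξ`,
`ε_v(ξ) = (−1)^{a(ξ) + d_v}` — from Proposition 3.1 (display) at `ψ₀`, Tate's twisting law (display) for
`ψ_δ = ψ₀(t·)`, and `ξ(t) = η_v(t) = (−1)^{d_v+1}`. -/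
theorem eps_of_isCS (hG : GGP2012ex_Prop3_1 D)
    (hT : Tate1979_3_2_2_3 D.epsT (fun ξ a => ((ξ a : ℂˣ) : ℂ)) D.tw D.sc D.nrm (fun _ => True))
    (hc : D.toCharDatum.Conventions) (hψδ : D.ψδ = D.tw D.ψ0 D.t) (ht : D.t ∈ D.Fsub)
    (hηt : ((D.η ⟨D.t, ht⟩ : ℂˣ) : ℂ) = (-1 : ℂ) ^ (D.d + 1))
    (hin : D.IsInert) (hψ0 : D.IsNormalised D.ψ0)
    {ξ : D.E →* ℂˣ} (hξ : D.toLocalSignDatum.IsCS ξ) (hs : D.IsSmooth ξ) :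
    D.eps ξ = Int.negOnePow ((D.cond ξ : ℤ) + D.d) := by
  have hrules := rules_of D.toCharDatum hT hc
  have h0 : D.tate.epsS (1 / 2) ξ D.ψ0 = (-1 : ℂ) ^ (D.cond ξ + 1) := hG hin D.ψ0 hψ0 ξ hξ hs
  have htw : D.tate.epsS (1 / 2) ξ (D.tate.tw D.ψ0 D.t) =
      D.tate.ev ξ D.t * D.tate.epsS (1 / 2) ξ D.ψ0 :=
    TateData.epsS_tw_half hrules ξ D.ψ0 D.t trivial
  have hev : D.tate.ev ξ D.t = (-1 : ℂ) ^ (D.d + 1) := by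
    change ((ξ D.t : ℂˣ) : ℂ) = _
    rw [← hηt]
    congr 1
    exact (isCS_iff D.toCharDatum ξ).mp hξ ⟨D.t, ht⟩
  have hval : D.tate.epsS (1 / 2) ξ D.ψδ = (-1 : ℂ) ^ ((D.cond ξ : ℤ) + D.d) := by
    have hψδ' : D.ψδ = D.tate.tw D.ψ0 D.t := hψδ
    rw [hψδ', htw, hev, h0, ← zpow_natCast, ← zpow_add₀ (by norm_num : (-1 : ℂ) ≠ 0)]
    have hexp : (D.d + 1) + ((D.cond ξ + 1 : ℕ) : ℤ) = ((D.cond ξ : ℤ) + D.d) + 2 := by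
      push_cast
      ring
    rw [hexp, zpow_add₀ (by norm_num : (-1 : ℂ) ≠ 0)]
    norm_num
  change toSign (D.tate.epsS (1 / 2) ξ D.ψδ) = _
  rw [hval, toSign_neg_one_zpow]

/-! ### Case (iii) of Theorem N5.T2 at an inert place -/

/-- The conductor `n_a ∈ {1, 2}` whose parity realises the sign `s`: `(−1)^{n_a + d} = s`. -/
theorem exists_cond_parity (s : ℤˣ) (d : ℤ) :
    ∃ n : ℕ, 1 ≤ n ∧ Int.negOnePow ((n : ℤ) + d) = s := by
  by_cases h1 : Int.negOnePow ((1 : ℤ) + d) = s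
  · exact ⟨1, le_rfl, by exact_mod_cast h1⟩
  · refine ⟨2, by norm_num, ?_⟩
    have h1' : Int.negOnePow ((1 : ℤ) + d) = -s := Int.units_ne_iff_eq_neg.mp h1
    have : ((2 : ℕ) : ℤ) + d = 1 + ((1 : ℤ) + d) := by push_cast; ring
    rw [this, Int.negOnePow_add, h1', Int.negOnePow_one, neg_one_mul, neg_neg]

/-- THEOREM N5.T2, CASE (iii) AT AN INERT PLACE (TIER5 §N5.12.2 (iii-inert)′) in the pair form of
`N5Local.localSolution_of_pair`: for the sign `s = s_a`, a conjugate-symplectic `a` with `ε_v(a) = s` and a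
conjugate-symplectic `c` with `ε_v(c) = −s` and `ε_v(c⁻¹a²) = −s` — `a` of conductor `n_a ∈ {1, 2}` with
`(−1)^{n_a + d_v} = s` (Lemma N5.L5), `c` of conductor `n_a + 1` (opposite parity), and
`a(c⁻¹a²) = a(c)` since `a(a²) ≤ a(a) < a(c)`. The hypotheses of case (iii) (`η_v(u) = −1`, `s_a = s_b`) are
not needed for the construction. -/
theorem hiii_of_inert (hG : GGP2012ex_Prop3_1 D)
    (hT : Tate1979_3_2_2_3 D.epsT (fun ξ a => ((ξ a : ℂˣ) : ℂ)) D.tw D.sc D.nrm (fun _ => True))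
    (hc : D.toCharDatum.Conventions) (hU : Antitone D.U) (hψδ : D.ψδ = D.tw D.ψ0 D.t) (ht : D.t ∈ D.Fsub)
    (hηt : ((D.η ⟨D.t, ht⟩ : ℂˣ) : ℂ) = (-1 : ℂ) ^ (D.d + 1))
    (hin : D.IsInert) (hψ0 : D.IsNormalised D.ψ0)
    (hμ : ∃ μ : D.E →* ℂˣ, D.toLocalSignDatum.IsCS μ ∧ D.IsUnramified μ)
    (hβ : ∀ n : ℕ, 1 ≤ n → ∃ β : D.E →* ℂˣ, D.toLocalSignDatum.IsCO β ∧ D.IsSmooth β ∧ D.cond β = n) :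
    ∃ a c : D.E →* ℂˣ, D.toLocalSignDatum.IsCS a ∧ D.toLocalSignDatum.IsCS c ∧
      D.eps a = D.ηLine 0 ∧ D.eps c = -D.ηLine 0 ∧ D.eps (c⁻¹ * a * a) = -D.ηLine 0 := by
  obtain ⟨na, hna, hpar⟩ := exists_cond_parity (D.ηLine 0) D.d
  obtain ⟨a, haCS, has, hacond⟩ := exists_isCS_cond D.toCharDatum hU hμ hβ na hna
  obtain ⟨c, hcCS, hcs, hccond⟩ := exists_isCS_cond D.toCharDatum hU hμ hβ (na + 1) (by omega)
  have hparity := fun (ξ : D.E →* ℂˣ) => eps_of_isCS D hG hT hc hψδ ht hηt hin hψ0 (ξ := ξ)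
  have hq_CS : D.toLocalSignDatum.IsCS (c⁻¹ * a * a) := isCS_inv_mul_mul D.toCharDatum haCS hcCS
  have hq_s : D.IsSmooth (c⁻¹ * a * a) :=
    isSmooth_mul D.toCharDatum hU (isSmooth_mul D.toCharDatum hU (isSmooth_inv D.toCharDatum hcs) has) has
  have hq_cond : D.cond (c⁻¹ * a * a) = na + 1 := by
    rw [cond_inv_mul_mul D.toCharDatum hU has hcs (by rw [hacond, hccond]; omega), hccond]
  have hflip : Int.negOnePow (((na + 1 : ℕ) : ℤ) + D.d) = -D.ηLine 0 := by
    have : ((na + 1 : ℕ) : ℤ) + D.d = 1 + ((na : ℤ) + D.d) := by push_cast; ring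
    rw [this, Int.negOnePow_add, hpar, Int.negOnePow_one, neg_one_mul]
  refine ⟨a, c, haCS, hcCS, ?_, ?_, ?_⟩
  · rw [hparity a haCS has, hacond, hpar]
  · rw [hparity c hcCS hcs, hccond, hflip]
  · rw [hparity _ hq_CS hq_s, hq_cond, hflip]

/-- THEOREM N5.T2 (`N5Local.N5Local_main`) at an inert place with case (iii) discharged: the coupled local
system is solvable for the local sign datum built from the concrete-character carriers. -/
theorem N5Local_main_inert (hG : GGP2012ex_Prop3_1 D)
    (hT : Tate1979_3_2_2_3 D.epsT (fun ξ a => ((ξ a : ℂˣ) : ℂ)) D.tw D.sc D.nrm (fun _ => True))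
    (hc : D.toCharDatum.Conventions) (hU : Antitone D.U) (hψδ : D.ψδ = D.tw D.ψ0 D.t) (ht : D.t ∈ D.Fsub)
    (hηt : ((D.η ⟨D.t, ht⟩ : ℂˣ) : ℂ) = (-1 : ℂ) ^ (D.d + 1))
    (hin : D.IsInert) (hψ0 : D.IsNormalised D.ψ0)
    (hμ : ∃ μ : D.E →* ℂˣ, D.toLocalSignDatum.IsCS μ ∧ D.IsUnramified μ)
    (hβ : ∀ n : ℕ, 1 ≤ n → ∃ β : D.E →* ℂˣ, D.toLocalSignDatum.IsCO β ∧ D.IsSmooth β ∧ D.cond β = n)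
    (h35 : BFGYYZ2025_Thm3_5 D.toLocalSignDatum)
    (hA1 : ∀ s : ℤˣ, ∃ α : D.E →* ℂˣ, D.toLocalSignDatum.IsCO α ∧ D.toLocalSignDatum.Theta s α)
    (hW : D.toLocalSignDatum.epsdW = 1) (hη : D.toLocalSignDatum.η * D.toLocalSignDatum.η = 1)
    (hχW : D.toLocalSignDatum.IsCS D.toLocalSignDatum.χW) :
    ∃ ξ : Fin 4 → D.E →* ℂˣ, LocalSolution D.toLocalSignDatum ξ :=
  N5Local_main D.toLocalSignDatum h35 hA1 hW hη hχW
    (fun _ _ => hiii_of_inert D hG hT hc hU hψδ ht hηt hin hψ0 hμ hβ)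

end Summit.Ventures.HodgeRepro2.T6.N5LocalInert
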